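import Summits.ValiantsHypothesis.ValiantsHypothesis.Theorems.GeneratorObstructionsPerGenDegreeSuperQPBiCollapsedPermanent
import Summits.ValiantsHypothesis.ValiantsHypothesis.Theorems.GeneratorObstructionsPerGenDegreeSuperQPCollapsedPermanentRays

/-!
# Route GeneratorObstructions — K1 `PerGenDegreeSuperQP` (stmt-ValiantsHypothesis-11654),
# line `per-side-atoms`: EVERY ray `j = r₁·r₂` (`r₁, r₂ ∣ m`) of `S(per_m)` is hit and carries an
# atom (doubly collapsed permanents as polystable degenerations of `per_m`)

Thirteenth support file of the line; consequences of `…BiCollapsedPermanent` (the doubly collapsed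
permanent `Q = per_m(x_{ik} ↦ y_{a(i), b(k)})`, `m = r₁ t₁ = r₂ t₂`, `a, b` balanced, is
polystable) and of the ray criterion (`…RayCriterion`):

* `rename_biCollapsedPer_mem_orbitClosure_per` — placing `y_{u,s}` at the matrix position
  `(u, s)` (`u < r₁ ≤ m`, `s < r₂ ≤ m`) exhibits `Q` as the renaming
  `x_{ik} ↦ x_{a(i), b(k)}` of `per_m`, a point of `End·per_m ⊆ Δ(per_m)`.
* `per_ray_hit_biCollapsed` — **the ray `j = r₁ r₂` of `S(per_m)` is hit**: `(k^{r₁r₂})^*`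
  occurs in `ℂ[Δ_m[per_m]]` for some `k ≥ 1`;
* `per_exists_ray_atom_biCollapsed` — hence `S(per_m)` has an ATOM `(k₀^{r₁r₂})^*` there
  (`…RectangularRays`), of degree `k₀ r₁ r₂ / m ≤ e(Q)` (BI 2017's minimal degree of `Q`).

So the set of rectangular directions known to be met by the occurrence monoid of the permanent
is `{(1^{r₁r₂})^* : r₁ ∣ m, r₂ ∣ m}` — all products of two divisors of `m` (Chow rays `j ∣ m`
for `r₂ = 1`, the top ray for `r₁ = r₂ = m`, the column-collapsed rays `m r` for `r₁ = m`); in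
moment-polytope terms, all these chamber vertices are vertices of the moment polytope of
`Δ(per_m)`. Whether the remaining directions (e.g. every `j` when `m` is prime, beyond
`1, m, m²`) are met, and above all the first-occurrence DEGREES on the met rays (a
super-quasi-polynomial one, infinitely often, is `stub_atomLate`:
`…RayCriterion.stub_atomLate_of_nullcone_inseparable`), remain open.

Honest framing: unconditional structure theorems; `stub_atomLate` (`c ≥ 2`), K1 and
`GenFlipThesis` remain OPEN; nothing here bears on VP versus VNP.
References: [BurgisserIkenmeyer2017] Prop. 2.8, Cor. 2.9, Def. 3.3; [MulmuleySohoni2001] §4.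
-/

set_option linter.dupNamespace false

noncomputable section

namespace Summit.ValiantsHypothesis.ValiantsHypothesis.Theorems.GeneratorObstructions.PerGenDegreeSuperQP

open MvPolynomial
open Literature.NumberTheory.DiophantineGeometry Literature.Computability.AlgebraicComplexity
  Literature.Computability.Complexity

variable {r₁ t₁ r₂ t₂ : ℕ}

/-- **The doubly collapsed permanent is a degeneration of the permanent**: placed at the matrix
positions `(u, s)`, it is the renaming `x_{ik} ↦ x_{a(i), b(k)}` of `per_m`, a point of the
endomorphism orbit, hence of `Δ(per_m)`. [cite: MulmuleySohoni2001, §4] -/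
theorem rename_biCollapsedPer_mem_orbitClosure_per (h : r₁ * t₁ = r₂ * t₂) (h₁ : r₁ ≤ r₁ * t₁)
    (h₂ : r₂ ≤ r₁ * t₁) :
    MvPolynomial.rename
        (fun y : Fin (r₁ * r₂) =>
          (toLex (Fin.castLE h₁ (finProdFinEquiv.symm y).1,
            Fin.castLE h₂ (finProdFinEquiv.symm y).2) : MatIdx (r₁ * t₁)))
        (MvPolynomial.rename
          (fun ik : Fin (r₁ * t₁) × Fin (r₁ * t₁) =>
            (finProdFinEquiv ((finProdFinEquiv.symm ik.1).1,
              (finProdFinEquiv.symm (Fin.cast h ik.2)).1) : Fin (r₁ * r₂)))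
          (perPoly (Fin (r₁ * t₁)) ℂ)) ∈
      orbitClosure (MvPolynomial.rename (toLex : Fin (r₁ * t₁) × Fin (r₁ * t₁) → MatIdx (r₁ * t₁))
        (perPoly (Fin (r₁ * t₁)) ℂ)) := by
  haveI : Infinite ℂ := CharZero.infinite ℂ
  have hmem := rename_mem_orbitClosure_of_selfMap
    (fun x : MatIdx (r₁ * t₁) =>
      (toLex (Fin.castLE h₁ (finProdFinEquiv.symm (ofLex x).1).1,
        Fin.castLE h₂ (finProdFinEquiv.symm (Fin.cast h (ofLex x).2)).1) : MatIdx (r₁ * t₁)))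
    (MvPolynomial.rename (toLex : Fin (r₁ * t₁) × Fin (r₁ * t₁) → MatIdx (r₁ * t₁))
      (perPoly (Fin (r₁ * t₁)) ℂ))
  rw [rename_rename] at hmem
  rw [rename_rename]
  have hfun : ((fun y : Fin (r₁ * r₂) =>
        (toLex (Fin.castLE h₁ (finProdFinEquiv.symm y).1,
          Fin.castLE h₂ (finProdFinEquiv.symm y).2) : MatIdx (r₁ * t₁))) ∘
      (fun ik : Fin (r₁ * t₁) × Fin (r₁ * t₁) =>
        (finProdFinEquiv ((finProdFinEquiv.symm ik.1).1,
          (finProdFinEquiv.symm (Fin.cast h ik.2)).1) : Fin (r₁ * r₂)))) =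
      ((fun x : MatIdx (r₁ * t₁) =>
        (toLex (Fin.castLE h₁ (finProdFinEquiv.symm (ofLex x).1).1,
          Fin.castLE h₂ (finProdFinEquiv.symm (Fin.cast h (ofLex x).2)).1) : MatIdx (r₁ * t₁))) ∘
        (toLex : Fin (r₁ * t₁) × Fin (r₁ * t₁) → MatIdx (r₁ * t₁))) := by
    funext ik
    simp only [Function.comp_apply, Equiv.symm_apply_apply, ofLex_toLex]
  rw [hfun]
  exact hmem

/-- **Every ray `j = r₁ r₂` (`r₁, r₂ ∣ m`) of `S(per_m)` is hit.** For `m = r₁ t₁ = r₂ t₂`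
(all `≥ 1`) the rectangular weight `(k^{r₁ r₂})^*` occurs in `ℂ[Δ_m[per_m]]` for some `k ≥ 1`:
the doubly collapsed permanent on `r₁ r₂` of the matrix variables is a polystable, hence
`SL_{r₁r₂}`-semistable, degeneration of `per_m`; then the ray criterion.
[cite: BurgisserIkenmeyer2017, Prop. 2.8 and Def. 3.3] -/
theorem per_ray_hit_biCollapsed (h : r₁ * t₁ = r₂ * t₂) (hr₁ : 0 < r₁) (ht₁ : 0 < t₁)
    (hr₂ : 0 < r₂) (ht₂ : 0 < t₂) :
    ∃ k : ℕ, 0 < k ∧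
      highestWeightSpace (orbitCoordRep (MvPolynomial.rename toLex (perPoly (Fin (r₁ * t₁)) ℂ)) (r₁ * t₁))
        (partitionWeightLex (r₁ * t₁) (Nat.Partition.rectangle (r₁ * r₂) k)) ≠ ⊥ := by
  have h₁ : r₁ ≤ r₁ * t₁ := Nat.le_mul_of_pos_right r₁ ht₁
  have h₂ : r₂ ≤ r₁ * t₁ := h ▸ Nat.le_mul_of_pos_right r₂ ht₂
  have hm : r₁ * t₁ ≠ 0 := (Nat.mul_pos hr₁ ht₁).ne'
  have hj : 0 < r₁ * r₂ := Nat.mul_pos hr₁ hr₂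
  have hκ : Function.Injective (fun y : Fin (r₁ * r₂) =>
      (toLex (Fin.castLE h₁ (finProdFinEquiv.symm y).1,
        Fin.castLE h₂ (finProdFinEquiv.symm y).2) : MatIdx (r₁ * t₁))) := by
    intro y y' hyy
    have h' := congrArg (fun x : MatIdx (r₁ * t₁) => ofLex x) hyy
    simp only [ofLex_toLex, Prod.mk.injEq] at h'
    apply finProdFinEquiv.symm.injective
    exact Prod.ext (Fin.castLE_injective h₁ h'.1) (Fin.castLE_injective h₂ h'.2)
  obtain ⟨k, hk, hocc⟩ := exists_hasHighestWeight_rectangle_of_isSLSemistable_projection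
    (matIdxEquiv (r₁ * t₁)) hm (perFormLex_isHomogeneous (r₁ * t₁)) hj _ hκ
    (biCollapsedPer_isHomogeneous h) (rename_biCollapsedPer_mem_orbitClosure_per h h₁ h₂)
    ((isPolystable_biCollapsedPer h hr₁ ht₁ ht₂).isSLSemistable (biCollapsedPer_ne_zero h))
  exact ⟨k, hk, hocc⟩

/-- **Each ray `j = r₁ r₂` carries an atom** (`m = r₁ t₁ = r₂ t₂`, all `≥ 1`): `S(per_m)` has an
ATOM `(k₀^{r₁r₂})^*`, `k₀ ≥ 1`, the first weight on the ray. [cite: BurgisserIkenmeyer2017, Prop. 2.8 and Def. 3.3] -/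
theorem per_exists_ray_atom_biCollapsed (h : r₁ * t₁ = r₂ * t₂) (hr₁ : 0 < r₁) (ht₁ : 0 < t₁)
    (hr₂ : 0 < r₂) (ht₂ : 0 < t₂) :
    ∃ k₀ : ℕ, 0 < k₀ ∧
      highestWeightSpace (orbitCoordRep (MvPolynomial.rename toLex (perPoly (Fin (r₁ * t₁)) ℂ)) (r₁ * t₁))
        (partitionWeightLex (r₁ * t₁) (Nat.Partition.rectangle (r₁ * r₂) k₀)) ≠ ⊥ ∧
      (∀ k : ℕ, 0 < k → k < k₀ →
        highestWeightSpace (orbitCoordRep (MvPolynomial.rename toLex (perPoly (Fin (r₁ * t₁)) ℂ)) (r₁ * t₁))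
          (partitionWeightLex (r₁ * t₁) (Nat.Partition.rectangle (r₁ * r₂) k)) = ⊥) ∧
      (∀ χ₁ χ₂ : Weight (MatIdx (r₁ * t₁)),
        χ₁ + χ₂ = partitionWeightLex (r₁ * t₁) (Nat.Partition.rectangle (r₁ * r₂) k₀) →
        χ₁ ≠ 0 → χ₂ ≠ 0 →
        highestWeightSpace (orbitCoordRep (MvPolynomial.rename toLex (perPoly (Fin (r₁ * t₁)) ℂ)) (r₁ * t₁)) χ₁ = ⊥ ∨
          highestWeightSpace (orbitCoordRep (MvPolynomial.rename toLex (perPoly (Fin (r₁ * t₁)) ℂ)) (r₁ * t₁)) χ₂ = ⊥) :=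
  exists_least_rectangle_atom _ _ (Nat.mul_pos hr₁ hr₂)
    (Nat.mul_le_mul (Nat.le_mul_of_pos_right r₁ ht₁) (h ▸ Nat.le_mul_of_pos_right r₂ ht₂))
    (per_ray_hit_biCollapsed h hr₁ ht₁ hr₂ ht₂)

/-- **Divisor form.** For `m ≥ 1` and any two divisors `j₁, j₂` of `m`, the ray `j₁ j₂` of
`S(per_m)` is hit. [cite: BurgisserIkenmeyer2017, Prop. 2.8 and Def. 3.3] -/
theorem per_ray_hit_of_dvd_dvd {m j₁ j₂ : ℕ} (hm : 0 < m) (hj₁ : j₁ ∣ m) (hj₂ : j₂ ∣ m) :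
    ∃ k : ℕ, 0 < k ∧
      highestWeightSpace (orbitCoordRep (MvPolynomial.rename toLex (perPoly (Fin m) ℂ)) m)
        (partitionWeightLex m (Nat.Partition.rectangle (j₁ * j₂) k)) ≠ ⊥ := by
  obtain ⟨t₁, rfl⟩ := hj₁
  obtain ⟨t₂, ht⟩ := hj₂
  have hj₁' : 0 < j₁ := Nat.pos_of_ne_zero fun h0 => by subst h0; simp at hm
  have ht₁ : 0 < t₁ := Nat.pos_of_ne_zero fun h0 => by subst h0; simp at hm
  have hj₂' : 0 < j₂ := Nat.pos_of_ne_zero fun h0 => by subst h0; simp at ht; omega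
  have ht₂ : 0 < t₂ := Nat.pos_of_ne_zero fun h0 => by subst h0; simp at ht; omega
  exact per_ray_hit_biCollapsed ht hj₁' ht₁ hj₂' ht₂

end Summit.ValiantsHypothesis.ValiantsHypothesis.Theorems.GeneratorObstructions.PerGenDegreeSuperQP

end
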